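import Summits.QuantumAdvantage.QuantumAdvantage.Theorems.WalkThreeStepFarReadWindow

/-!
# Rung (G♯₂) `ThreeStepFreeRungFive` (item stmt-QuantumAdvantage-23286), architecture (U), the FAR-READ LEMMA 5d/6: the WITNESS
# (freedom lemma)

Cell qa-qnc0, route OddPrimeWalk, support item stmt-QuantumAdvantage-23286; prover qn-prover-3 g17.

In a `Scene` the far cut `hq` is non-constant and reads `π` with coefficient `a ≠ 0`.  We construct an indicator input `x* = indic P`
with `10` at `π` and at `h` on which the `π`-difference of `hq` is `δ(x*) = 1`, of the shape `P = {π−1, h−1} ∪ [β, β+j)` with the block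
placed in one of three "freedom regions" (below everything, between, above everything — each with two candidate positions so that the
other read `ρ_h` straddles none), or — in the RIGID case `γ = 0`, `b = −a`, `ρ_h` close to `π`, where every block coefficient vanishes
and the fire bit is a short window count — in the window next to `π`, using the non-constancy of `hq` to know the offset `r` is in range
(`exists_wit_rigid`).  The witness keeps clear of the family blocks `[h−6,h−1) ∪ [h+1,h+6)` always, and of `[π−6,π−1) ∪ [π+1,π+6)`
whenever `ρ_h` is within `5` of `h` (`Scene.exists_witness`).
WHAT THIS IS NOT: the contradiction itself is file 6/6; separation NOT moved.
-/

namespace Summit.QuantumAdvantage.AdviceFreeQNC0.LocalEngine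

open Finset Classical

namespace RungU

variable {n : ℕ}

namespace Scene

variable (sc : Scene n)

/-- **rigid witness**: with `γ = 0`, `b = −a`, `ρ_h` between `15` and `π + 45` (and `ρ_h ≥ h + 35` on the lower side), some window
witness has `δ = 1`. -/
theorem exists_wit_rigid (hγ : sc.S.γ sc.hq = 0) (hb : otherCoef sc.S sc.hq sc.π = -cf sc.S sc.hq sc.π)
    (hlo : 15 ≤ sc.ρh) (hhi : sc.ρh ≤ sc.π + 45) (hhρ : sc.h < sc.π → sc.h + 35 ≤ sc.ρh) :
    ∃ β j : ℕ, j < 5 ∧ ((β + j = sc.π - 1 ∧ sc.π - 5 ≤ β) ∨ β = sc.π + 1) ∧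
      dlt sc.S sc.π (indic (sc.wit β j) : Fin n → Bool) sc.hq = true := by
  have hr := sc.room
  have hh := sc.h_bounds
  have hfar := sc.far
  have ha := sc.reads
  have hiff : sc.h - 1 < sc.ρh ↔ sc.h - 1 < sc.π := by
    constructor
    · intro h1; by_contra h2; rcases hfar with hf | hf <;> omega
    · intro h1; have := hhρ (by omega); omega
  -- ρ_h ≠ π: the other coefficient is non-zero
  have hρπ : sc.ρh ≠ sc.π := by
    intro e
    have : otherCoef sc.S sc.hq sc.π = 0 := by unfold otherCoef; unfold ρh at e; rw [if_pos e]
    rw [this] at hb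
    exact ha (neg_eq_zero.mp hb.symm)
  obtain ⟨u, hu⟩ := exists_fire sc.S sc.hq sc.nonconst
  have hPlo : ∀ v : ℕ, v ≤ 4 → ∀ i ∈ sc.wit (sc.π - 1 - v) v, i < n := fun v hv i hi => by rw [mem_wit] at hi; omega
  have hPhi : ∀ v : ℕ, v ≤ 4 → ∀ i ∈ sc.wit (sc.π + 1) v, i < n := fun v hv i hi => by rw [mem_wit] at hi; omega
  have memlo : ∀ v : ℕ, v ≤ 4 → sc.π - 1 ∈ sc.wit (sc.π - 1 - v) v ∧ sc.π ∉ sc.wit (sc.π - 1 - v) v := fun v hv =>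
    ⟨sc.mem_wit.mpr (Or.inl rfl), fun hm => by rw [mem_wit] at hm; omega⟩
  have memhi : ∀ v : ℕ, sc.π - 1 ∈ sc.wit (sc.π + 1) v ∧ sc.π ∉ sc.wit (sc.π + 1) v := fun v =>
    ⟨sc.mem_wit.mpr (Or.inl rfl), fun hm => by rw [mem_wit] at hm; omega⟩
  by_cases c1 : sc.ρh + 6 ≤ sc.π
  · -- far below π: the lower window covers all residues
    obtain ⟨v, hv, e⟩ := exists_step_hit _ (cf sc.S sc.hq sc.π) (sc.S.r sc.hq) ha
    refine ⟨sc.π - 1 - v, v, hv, Or.inl ⟨by omega, by omega⟩, ?_⟩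
    apply sc.dlt_true_of_lv _ (hPlo v (by omega)) (memlo v (by omega)).1 (memlo v (by omega)).2
    left
    rw [sc.lv_lo hγ hb v (by omega) (by omega) hiff]
    exact e
  by_cases c2 : sc.ρh + 1 ≤ sc.π
  · -- ρ_h ∈ [π-5, π-1]: rigid lower window; use the firing input
    obtain ⟨c, hc, hcr⟩ := sc.fire_window_lo hγ hb (by omega) hu
    by_cases hc0 : c = 0
    · refine ⟨sc.π - 1 - 0, 0, by omega, Or.inl ⟨by omega, by omega⟩, ?_⟩
      apply sc.dlt_true_of_lv _ (hPlo 0 (by omega)) (memlo 0 (by omega)).1 (memlo 0 (by omega)).2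
      right
      rw [sc.lv_lo hγ hb 0 (by omega) (by omega) hiff, ← hcr, hc0]
      push_cast; ring
    · refine ⟨sc.π - 1 - (c - 1), c - 1, by omega, Or.inl ⟨by omega, by omega⟩, ?_⟩
      apply sc.dlt_true_of_lv _ (hPlo (c - 1) (by omega)) (memlo (c - 1) (by omega)).1 (memlo (c - 1) (by omega)).2
      left
      rw [sc.lv_lo hγ hb (c - 1) (by omega) (by omega) hiff, ← hcr]
      rw [show ((c : ℕ) : ZMod 5) = (((c - 1 : ℕ) : ℕ) : ZMod 5) + 1 from by
        rw [show c = (c - 1) + 1 from by omega]; push_cast; ring_nf]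
      ring
  have hρ1 : sc.π + 1 ≤ sc.ρh := by omega
  by_cases c3 : sc.ρh ≤ sc.π + 5
  · -- ρ_h ∈ [π+1, π+5]: rigid upper window
    obtain ⟨c, hc, hcr⟩ := sc.fire_window_hi hγ hb (by omega) hu
    by_cases hce : sc.π + c = sc.ρh
    · refine ⟨sc.π + 1, c - 1, by omega, Or.inr rfl, ?_⟩
      apply sc.dlt_true_of_lv _ (hPhi (c - 1) (by omega)) (memhi (c - 1)).1 (memhi (c - 1)).2
      right
      rw [sc.lv_hi hγ hb (c - 1) (by omega) (by omega) hiff, ← hcr]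
      rw [show ((c : ℕ) : ZMod 5) = (((c - 1 : ℕ) : ℕ) : ZMod 5) + 1 from by
        rw [show c = (c - 1) + 1 from by omega]; push_cast; ring_nf]
      ring
    · refine ⟨sc.π + 1, c, by omega, Or.inr rfl, ?_⟩
      apply sc.dlt_true_of_lv _ (hPhi c (by omega)) (memhi c).1 (memhi c).2
      left
      rw [sc.lv_hi hγ hb c (by omega) (by omega) hiff, ← hcr]
  · -- ρ_h ∈ [π+6, π+45]: the upper window covers all residues
    obtain ⟨v, hv, e⟩ := exists_step_hit (-cf sc.S sc.hq sc.π) 0 (sc.S.r sc.hq) (neg_ne_zero.mpr ha)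
    refine ⟨sc.π + 1, v, hv, Or.inr rfl, ?_⟩
    apply sc.dlt_true_of_lv _ (hPhi v (by omega)) (memhi v).1 (memhi v).2
    left
    rw [sc.lv_hi hγ hb v (by omega) (by omega) hiff, ← e]
    ring

/-! ### §4 The witness -/

/-- **THE WITNESS** (freedom lemma): an indicator input with `10` at `π` and `h`, `δ = 1`, clear of the family blocks. -/
theorem exists_witness :
    ∃ P : Finset ℕ, (∀ j ∈ P, j < n) ∧ sc.π - 1 ∈ P ∧ sc.π ∉ P ∧ sc.h - 1 ∈ P ∧ sc.h ∉ P ∧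
      dlt sc.S sc.π (indic P : Fin n → Bool) sc.hq = true ∧
      (∀ j ∈ P, ¬ (sc.h - 6 ≤ j ∧ j < sc.h - 1) ∧ ¬ (sc.h + 1 ≤ j ∧ j < sc.h + 6)) ∧
      ((sc.h ≤ sc.ρh + 5 ∧ sc.ρh ≤ sc.h + 5) →
        ∀ j ∈ P, ¬ (sc.π - 6 ≤ j ∧ j < sc.π - 1) ∧ ¬ (sc.π + 1 ≤ j ∧ j < sc.π + 6)) := by
  have hr := sc.room
  have hh := sc.h_bounds
  have hfar := sc.far
  have ha := sc.reads
  set a := cf sc.S sc.hq sc.π with hadef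
  set b := otherCoef sc.S sc.hq sc.π with hbdef
  set γ := sc.S.γ sc.hq with hγdef
  set ℓ := min sc.π sc.h with hℓ
  set u := max sc.π sc.h with hu
  have hℓu : (ℓ = sc.π ∧ u = sc.h ∧ sc.π + 128 ≤ sc.h) ∨ (ℓ = sc.h ∧ u = sc.π ∧ sc.h + 128 ≤ sc.π) := by
    rcases hfar with hf | hf
    · left; rw [hℓ, hu, min_eq_left (by omega), max_eq_right (by omega)]; exact ⟨rfl, rfl, hf⟩
    · right; rw [hℓ, hu, min_eq_right (by omega), max_eq_left (by omega)]; exact ⟨rfl, rfl, hf⟩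
  -- the three freedom blocks, each avoiding a straddle by ρ_h
  set β1 := (if 10 < sc.ρh ∧ sc.ρh < 15 then 20 else 10) with hβ1
  set β2 := (if ℓ + 30 < sc.ρh ∧ sc.ρh < ℓ + 35 then ℓ + 40 else ℓ + 30) with hβ2
  set β3 := (if u + 7 < sc.ρh ∧ sc.ρh < u + 12 then u + 17 else u + 7) with hβ3
  have s1 : β1 + 5 ≤ sc.ρh ∨ sc.ρh ≤ β1 := by rw [hβ1]; split_ifs <;> omega
  have s2 : β2 + 5 ≤ sc.ρh ∨ sc.ρh ≤ β2 := by rw [hβ2]; split_ifs <;> omega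
  have s3 : β3 + 5 ≤ sc.ρh ∨ sc.ρh ≤ β3 := by rw [hβ3]; split_ifs <;> omega
  have r1 : 10 ≤ β1 ∧ β1 ≤ 20 := by rw [hβ1]; split_ifs <;> omega
  have r2 : ℓ + 30 ≤ β2 ∧ β2 ≤ ℓ + 40 := by rw [hβ2]; split_ifs <;> omega
  have r3 : u + 7 ≤ β3 ∧ β3 ≤ u + 17 := by rw [hβ3]; split_ifs <;> omega
  -- packaging a block witness
  have pack : ∀ β : ℕ, (10 ≤ β ∧ β ≤ 20) ∨ (ℓ + 30 ≤ β ∧ β ≤ ℓ + 40) ∨ (u + 7 ≤ β ∧ β ≤ u + 17) →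
      (∃ j : ℕ, j < 5 ∧ dlt sc.S sc.π (indic (sc.wit β j) : Fin n → Bool) sc.hq = true) →
      ∃ P : Finset ℕ, (∀ j ∈ P, j < n) ∧ sc.π - 1 ∈ P ∧ sc.π ∉ P ∧ sc.h - 1 ∈ P ∧ sc.h ∉ P ∧
        dlt sc.S sc.π (indic P : Fin n → Bool) sc.hq = true ∧
        (∀ j ∈ P, ¬ (sc.h - 6 ≤ j ∧ j < sc.h - 1) ∧ ¬ (sc.h + 1 ≤ j ∧ j < sc.h + 6)) ∧
        ((sc.h ≤ sc.ρh + 5 ∧ sc.ρh ≤ sc.h + 5) →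
          ∀ j ∈ P, ¬ (sc.π - 6 ≤ j ∧ j < sc.π - 1) ∧ ¬ (sc.π + 1 ≤ j ∧ j < sc.π + 6)) := by
    intro β hβ ⟨j, hj, hd⟩
    refine ⟨sc.wit β j, fun i hi => ?_, sc.mem_wit.mpr (Or.inl rfl), fun hm => ?_, sc.mem_wit.mpr (Or.inr (Or.inl rfl)),
      fun hm => ?_, hd, fun i hi => ?_, fun _ i hi => ?_⟩
    · rw [mem_wit] at hi; rcases hℓu with ⟨e1, e2, e3⟩ | ⟨e1, e2, e3⟩ <;> rw [e1, e2] at hβ <;> omega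
    · rw [mem_wit] at hm; rcases hℓu with ⟨e1, e2, e3⟩ | ⟨e1, e2, e3⟩ <;> rw [e1, e2] at hβ <;> omega
    · rw [mem_wit] at hm; rcases hℓu with ⟨e1, e2, e3⟩ | ⟨e1, e2, e3⟩ <;> rw [e1, e2] at hβ <;> omega
    · rw [mem_wit] at hi; rcases hℓu with ⟨e1, e2, e3⟩ | ⟨e1, e2, e3⟩ <;> rw [e1, e2] at hβ <;> omega
    · rw [mem_wit] at hi; rcases hℓu with ⟨e1, e2, e3⟩ | ⟨e1, e2, e3⟩ <;> rw [e1, e2] at hβ <;> omega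
  -- the coefficients of the three blocks
  by_cases k1 : a * (if β1 + 5 ≤ sc.π then 1 else 0) + b * (if β1 + 5 ≤ sc.ρh then 1 else 0) + γ ≠ 0
  · apply pack β1 (Or.inl r1)
    exact sc.exists_wit_of_block β1 (by omega) (Or.inl (by omega)) (Or.inl (by omega)) s1 k1
  by_cases k2 : a * (if β2 + 5 ≤ sc.π then 1 else 0) + b * (if β2 + 5 ≤ sc.ρh then 1 else 0) + γ ≠ 0
  · apply pack β2 (Or.inr (Or.inl r2))
    rcases hℓu with ⟨e1, e2, e3⟩ | ⟨e1, e2, e3⟩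
    · exact sc.exists_wit_of_block β2 (by omega) (Or.inr (by omega)) (Or.inl (by omega)) s2 k2
    · exact sc.exists_wit_of_block β2 (by omega) (Or.inl (by omega)) (Or.inr (by omega)) s2 k2
  by_cases k3 : a * (if β3 + 5 ≤ sc.π then 1 else 0) + b * (if β3 + 5 ≤ sc.ρh then 1 else 0) + γ ≠ 0
  · apply pack β3 (Or.inr (Or.inr r3))
    rcases hℓu with ⟨e1, e2, e3⟩ | ⟨e1, e2, e3⟩
    · exact sc.exists_wit_of_block β3 (by omega) (Or.inr (by omega)) (Or.inr (by omega)) s3 k3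
    · exact sc.exists_wit_of_block β3 (by omega) (Or.inr (by omega)) (Or.inr (by omega)) s3 k3
  -- all three coefficients vanish: the rigid case
  push Not at k1 k2 k3
  rw [if_pos (by omega)] at k1
  rw [if_neg (by omega)] at k3
  -- derive γ = 0, b = -a, and the position of ρ_h
  have hrig : γ = 0 ∧ b = -a ∧ 15 ≤ sc.ρh ∧ sc.ρh ≤ sc.π + 45 ∧ (sc.h < sc.π → sc.h + 35 ≤ sc.ρh) := by
    rcases hℓu with ⟨e1, e2, e3⟩ | ⟨e1, e2, e3⟩
    · -- upper orientation: block 2 is above π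
      rw [e1] at r2; rw [e2] at r3
      rw [if_neg (by omega)] at k2
      by_cases l3 : β3 + 5 ≤ sc.ρh
      · rw [if_pos l3] at k3
        by_cases l2 : β2 + 5 ≤ sc.ρh
        · rw [if_pos l2] at k2
          by_cases l1 : β1 + 5 ≤ sc.ρh
          · rw [if_pos l1] at k1
            exfalso; apply ha; linear_combination k1 - k2
          · exfalso; omega
        · exfalso; omega
      · rw [if_neg l3] at k3
        have hγ0 : γ = 0 := by simpa using k3
        rw [hγ0] at k2 k1
        by_cases l2 : β2 + 5 ≤ sc.ρh
        · rw [if_pos l2] at k2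
          have hb0 : b = 0 := by simpa using k2
          rw [hb0] at k1
          exfalso; apply ha; simpa using k1
        · by_cases l1 : β1 + 5 ≤ sc.ρh
          · rw [if_pos l1] at k1
            refine ⟨hγ0, by linear_combination k1, by omega, by omega, fun hlt => by omega⟩
          · rw [if_neg l1] at k1
            exfalso; apply ha; simpa using k1
    · -- lower orientation: block 2 is below π
      rw [e1] at r2; rw [e2] at r3
      rw [if_pos (by omega)] at k2
      by_cases l3 : β3 + 5 ≤ sc.ρh
      · rw [if_pos l3] at k3
        by_cases l2 : β2 + 5 ≤ sc.ρh
        · rw [if_pos l2] at k2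
          exfalso; apply ha; linear_combination k2 - k3
        · exfalso; omega
      · rw [if_neg l3] at k3
        have hγ0 : γ = 0 := by simpa using k3
        rw [hγ0] at k2 k1
        by_cases l2 : β2 + 5 ≤ sc.ρh
        · rw [if_pos l2] at k2
          by_cases l1 : β1 + 5 ≤ sc.ρh
          · rw [if_pos l1] at k1
            refine ⟨hγ0, by linear_combination k2, by omega, by omega, fun _ => by omega⟩
          · exfalso; omega
        · rw [if_neg l2] at k2
          exfalso; apply ha; simpa using k2
  obtain ⟨hγ0, hb0, hlo, hhi, hhρ⟩ := hrig
  obtain ⟨β, j, hj, hβ, hd⟩ := sc.exists_wit_rigid hγ0 hb0 hlo hhi hhρ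
  refine ⟨sc.wit β j, fun i hi => ?_, sc.mem_wit.mpr (Or.inl rfl), fun hm => ?_, sc.mem_wit.mpr (Or.inr (Or.inl rfl)),
    fun hm => ?_, hd, fun i hi => ?_, fun hnear => ?_⟩
  · rw [mem_wit] at hi; rcases hβ with ⟨e1, e2⟩ | e1 <;> omega
  · rw [mem_wit] at hm; rcases hβ with ⟨e1, e2⟩ | e1 <;> omega
  · rw [mem_wit] at hm; rcases hβ with ⟨e1, e2⟩ | e1 <;> omega
  · rw [mem_wit] at hi; rcases hβ with ⟨e1, e2⟩ | e1 <;> omega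
  · exfalso
    rcases hℓu with ⟨e1, e2, e3⟩ | ⟨e1, e2, e3⟩
    · omega
    · have := hhρ (by omega); omega

end Scene

end RungU

end Summit.QuantumAdvantage.AdviceFreeQNC0.LocalEngine
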